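import Summits.CriticalPhenomena.PercolationContinuityZ3.Theorems.PercNearOneGluingNoHeavyLowerTailThreePointGammaCombMonotone
import HarnessLib

/-!
# `NoHeavyLowerTail` (stmt-CriticalPhenomena-4575) — comb positivity of `Γ`, III: weight-free pull-back of the certificate and the state/triple dictionary

Support file (prover prim-ineq-gen-2 gen 5; `--supports stmt-CriticalPhenomena-4575`).  Small technical definitions, no named facts, no sorries.
Towards Lemma 1 of GAMMA-COMB-THEOREM.md (the complete-monotonicity sums at diagonal bases ARE the interval splits of `Γ`):
(1) the two switchings `Φ₃, Φ₄` permute the copies edgewise, so they preserve the copy-count vector `kvec` and — being weight-preserving bijections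
(`sum_wt3W_phi3/4` at `p ≡ ½`) — any sum over triples weighted by a function of `kvec` can be pulled back through them (`sum_kvec_comp_phi3/4`);
(2) the states `κ ∈ Asg M` over the diagonal base `(O,O,O)` are exactly the triples with copy counts `3` on `O`, `≤ 1` on `M`, `0` elsewhere, with
`sgn κ = (−1)^{#{e ∈ M : count 0}}` (`sum_Asg_eq_sum_triples`).  Part IV sums out copy `0` and identifies the kernel.
-/

noncomputable section

namespace Summit.CriticalPhenomena.PercolationContinuityZ3.Theorems

namespace ThreePointGamma

open Finset Literature.Probability.Percolation Literature.Probability.Percolation.DecisionTree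
open Literature.Probability.Percolation.Gladkov ThreePointLB
open scoped Classical

variable {V : Type*} [Fintype V] [DecidableEq V]

/-! ### Copy counts are preserved by the switchings -/

section Counts

variable (a b : V)

omit [Fintype V] in
/-- The number of copies of the triple containing the pair `e`. [this work] -/
def kvec (x : Fin 3 → Finset (Sym2 V)) (e : Sym2 V) : ℕ :=
  (if e ∈ x 0 then 1 else 0) + (if e ∈ x 1 then 1 else 0) + (if e ∈ x 2 then 1 else 0)

/-- `Φ₃` permutes the copies edgewise, hence preserves the copy counts. [this work] -/
theorem kvec_phi3 (x : Fin 3 → Finset (Sym2 V)) : kvec (phi3 a b x) = kvec x := by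
  funext e
  by_cases hR : e ∈ touch (cl (x 0) a)
  · have hS : e ∉ touch (cl (x 0) b) \ touch (cl (x 0) a) := fun h => (mem_sdiff.1 h).2 hR
    have h0 : e ∈ phi3 a b x 0 ↔ e ∈ x 1 := by rw [phi3_zero, mem_splice_of_mem hR]
    have h1 : e ∈ phi3 a b x 1 ↔ e ∈ x 0 := by rw [phi3_one, mem_splice_of_mem hR]
    have h2 : e ∈ phi3 a b x 2 ↔ e ∈ x 2 := by rw [phi3_two, mem_splice_of_not_mem hS]
    simp only [kvec, h0, h1, h2]; ring
  · by_cases hS : e ∈ touch (cl (x 0) b) \ touch (cl (x 0) a)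
    · have h0 : e ∈ phi3 a b x 0 ↔ e ∈ x 2 := by rw [phi3_zero, mem_splice_of_not_mem hR, mem_splice_of_mem hS]
      have h1 : e ∈ phi3 a b x 1 ↔ e ∈ x 1 := by rw [phi3_one, mem_splice_of_not_mem hR]
      have h2 : e ∈ phi3 a b x 2 ↔ e ∈ x 0 := by rw [phi3_two, mem_splice_of_mem hS]
      simp only [kvec, h0, h1, h2]; ring
    · have h0 : e ∈ phi3 a b x 0 ↔ e ∈ x 0 := by rw [phi3_zero, mem_splice_of_not_mem hR, mem_splice_of_not_mem hS]
      have h1 : e ∈ phi3 a b x 1 ↔ e ∈ x 1 := by rw [phi3_one, mem_splice_of_not_mem hR]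
      have h2 : e ∈ phi3 a b x 2 ↔ e ∈ x 2 := by rw [phi3_two, mem_splice_of_not_mem hS]
      simp only [kvec, h0, h1, h2]

/-- `Φ₄` permutes the copies edgewise, hence preserves the copy counts. [this work] -/
theorem kvec_phi4 (x : Fin 3 → Finset (Sym2 V)) : kvec (phi4 a b x) = kvec x := by
  funext e
  by_cases hR : e ∈ touch (cl (x 0) b)
  · have hS : e ∉ touch (cl (x 0) a) \ touch (cl (x 0) b) := fun h => (mem_sdiff.1 h).2 hR
    have h0 : e ∈ phi4 a b x 0 ↔ e ∈ x 2 := by rw [phi4_zero, mem_splice_of_mem hR]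
    have h1 : e ∈ phi4 a b x 1 ↔ e ∈ x 1 := by rw [phi4_one, mem_splice_of_not_mem hS]
    have h2 : e ∈ phi4 a b x 2 ↔ e ∈ x 0 := by rw [phi4_two, mem_splice_of_mem hR]
    simp only [kvec, h0, h1, h2]; ring
  · by_cases hS : e ∈ touch (cl (x 0) a) \ touch (cl (x 0) b)
    · have h0 : e ∈ phi4 a b x 0 ↔ e ∈ x 1 := by rw [phi4_zero, mem_splice_of_not_mem hR, mem_splice_of_mem hS]
      have h1 : e ∈ phi4 a b x 1 ↔ e ∈ x 0 := by rw [phi4_one, mem_splice_of_mem hS]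
      have h2 : e ∈ phi4 a b x 2 ↔ e ∈ x 2 := by rw [phi4_two, mem_splice_of_not_mem hR]
      simp only [kvec, h0, h1, h2]; ring
    · have h0 : e ∈ phi4 a b x 0 ↔ e ∈ x 0 := by rw [phi4_zero, mem_splice_of_not_mem hR, mem_splice_of_not_mem hS]
      have h1 : e ∈ phi4 a b x 1 ↔ e ∈ x 1 := by rw [phi4_one, mem_splice_of_not_mem hS]
      have h2 : e ∈ phi4 a b x 2 ↔ e ∈ x 2 := by rw [phi4_two, mem_splice_of_not_mem hR]
      simp only [kvec, h0, h1, h2]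

variable (D : Finset (Sym2 V))

omit [Fintype V] in
/-- At `p ≡ ½` every triple has the same weight. [folklore] -/
theorem wt3W_half (x : Fin 3 → Finset (Sym2 V)) : wt3W D (fun _ : Sym2 V => (1 / 2 : ℝ)) x = ((1 / 2 : ℝ) ^ D.card) ^ 3 := by
  unfold wt3W wtW
  have h : ∀ S : Finset (Sym2 V), ∏ i ∈ D, (if i ∈ S then (1 / 2 : ℝ) else 1 - 1 / 2) = (1 / 2) ^ D.card := by
    intro S
    rw [← prod_const]
    exact prod_congr rfl fun i _ => by split_ifs <;> norm_num
  simp only [h, Fin.prod_univ_three]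
  ring

/-- **Counting form of the switching lemma for `Φ₃`**: it is a bijection of the triples inside `D`. [this work] -/
theorem sum_comp_phi3 (f : (Fin 3 → Finset (Sym2 V)) → ℝ) : ∑ x ∈ triples D, f (phi3 a b x) = ∑ x ∈ triples D, f x := by
  have h := sum_wt3W_phi3 (fun _ : Sym2 V => (1 / 2 : ℝ)) D a b f
  simp only [wt3W_half, ← mul_sum] at h
  exact mul_left_cancel₀ (by positivity) h

/-- **Counting form of the switching lemma for `Φ₄`.** [this work] -/
theorem sum_comp_phi4 (f : (Fin 3 → Finset (Sym2 V)) → ℝ) : ∑ x ∈ triples D, f (phi4 a b x) = ∑ x ∈ triples D, f x := by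
  have h := sum_wt3W_phi4 (fun _ : Sym2 V => (1 / 2 : ℝ)) D a b f
  simp only [wt3W_half, ← mul_sum] at h
  exact mul_left_cancel₀ (by positivity) h

/-- Pull-back through `Φ₃` of a sum weighted by a function of the copy counts. [this work] -/
theorem sum_kvec_comp_phi3 (s : (Sym2 V → ℕ) → ℝ) (g : Finset (Sym2 V) → Finset (Sym2 V) → ℝ) :
    ∑ x ∈ triples D, s (kvec x) * g (phi3 a b x 1) (phi3 a b x 2) = ∑ x ∈ triples D, s (kvec x) * g (x 1) (x 2) := by
  have h := sum_comp_phi3 a b D (fun y => s (kvec y) * g (y 1) (y 2))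
  simp only [kvec_phi3] at h
  exact h

/-- Pull-back through `Φ₄` of a sum weighted by a function of the copy counts. [this work] -/
theorem sum_kvec_comp_phi4 (s : (Sym2 V → ℕ) → ℝ) (g : Finset (Sym2 V) → Finset (Sym2 V) → ℝ) :
    ∑ x ∈ triples D, s (kvec x) * g (phi4 a b x 1) (phi4 a b x 2) = ∑ x ∈ triples D, s (kvec x) * g (x 1) (x 2) := by
  have h := sum_comp_phi4 a b D (fun y => s (kvec y) * g (y 1) (y 2))
  simp only [kvec_phi4] at h
  exact h

end Counts

/-! ### States over a diagonal base as triples -/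

section Dict

variable (D O M : Finset (Sym2 V))

omit [Fintype V] in
/-- The copy-count pattern of the states of `M` over the diagonal base `(O,O,O)`: `3` on `O`, `≤ 1` on `M`, `0` elsewhere. [this work] -/
def patt (k : Sym2 V → ℕ) : Prop := ∀ e, (e ∈ O → k e = 3) ∧ (e ∈ M → k e ≤ 1) ∧ (e ∉ O → e ∉ M → k e = 0)

omit [Fintype V] in
/-- The sign of a pattern: `(−1)^{#{e ∈ M : count 0}}`. [this work] -/
def psgn (k : Sym2 V → ℕ) : ℝ := (-1) ^ (M.filter (fun e => k e = 0)).card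

omit [Fintype V] in
/-- The weight of a triple in the dictionary: the pattern sign if the pattern fits, else `0`. [this work] -/
def pwt (k : Sym2 V → ℕ) : ℝ := if patt O M k then psgn M k else 0

variable {D O M}

omit [Fintype V] in
/-- Components of `trip O O O κ`. [this work] -/
theorem trip_diag (κ : St V) : trip O O O κ 0 = O ∪ κ.1 ∧ trip O O O κ 1 = O ∪ κ.2.1 ∧ trip O O O κ 2 = O ∪ κ.2.2 := by
  unfold trip; simp

omit [Fintype V] in
/-- The copy counts of a state triple. [this work] -/
theorem kvec_trip (κ : St V) (e : Sym2 V) :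
    kvec (trip O O O κ) e = (if e ∈ O ∪ κ.1 then 1 else 0) + (if e ∈ O ∪ κ.2.1 then 1 else 0) + (if e ∈ O ∪ κ.2.2 then 1 else 0) := by
  unfold kvec; rw [(trip_diag κ).1, (trip_diag κ).2.1, (trip_diag κ).2.2]

omit [Fintype V] in
/-- A state triple fits the pattern. [this work] -/
theorem patt_trip (hOM : Disjoint O M) {κ : St V} (hκ : κ ∈ Asg M) : patt O M (kvec (trip O O O κ)) := by
  obtain ⟨h1, h2, h3, d12, d13, d23⟩ := mem_Asg.1 hκ
  intro e
  rw [kvec_trip]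
  refine ⟨fun heO => by simp [heO], fun heM => ?_, fun heO heM => ?_⟩
  · have heO : e ∉ O := fun h => disjoint_left.1 hOM h heM
    by_cases e1 : e ∈ κ.1
    · have e2 : e ∉ κ.2.1 := fun h => disjoint_left.1 d12 e1 h
      have e3 : e ∉ κ.2.2 := fun h => disjoint_left.1 d13 e1 h
      simp [heO, e1, e2, e3]
    · by_cases e2 : e ∈ κ.2.1
      · have e3 : e ∉ κ.2.2 := fun h => disjoint_left.1 d23 e2 h
        simp [heO, e1, e2, e3]
      · by_cases e3 : e ∈ κ.2.2 <;> simp [heO, e1, e2, e3]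
  · have e1 : e ∉ κ.1 := fun h => heM (h1 h)
    have e2 : e ∉ κ.2.1 := fun h => heM (h2 h)
    have e3 : e ∉ κ.2.2 := fun h => heM (h3 h)
    simp [heO, e1, e2, e3]

omit [Fintype V] in
/-- For `e ∈ M`, the copy count of a state triple vanishes iff `e` is in no component. [this work] -/
theorem kvec_trip_eq_zero_iff (hOM : Disjoint O M) (κ : St V) {e : Sym2 V} (heM : e ∈ M) :
    kvec (trip O O O κ) e = 0 ↔ (e ∉ κ.1 ∧ e ∉ κ.2.1 ∧ e ∉ κ.2.2) := by
  have heO : e ∉ O := fun h => disjoint_left.1 hOM h heM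
  rw [kvec_trip]
  simp only [mem_union, heO, false_or]
  constructor
  · intro h
    refine ⟨fun h1 => ?_, fun h2 => ?_, fun h3 => ?_⟩
    · simp [h1] at h
    · simp [h2] at h
    · simp [h3] at h
  · rintro ⟨h1, h2, h3⟩; simp [h1, h2, h3]

omit [Fintype V] in
/-- The pattern sign of a state triple is the state sign. [this work] -/
theorem psgn_trip (hOM : Disjoint O M) (κ : St V) : psgn M (kvec (trip O O O κ)) = sgn M κ := by
  unfold psgn sgn
  have hset : M.filter (fun e => kvec (trip O O O κ) e = 0) = M \ (κ.1 ∪ κ.2.1 ∪ κ.2.2) := by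
    ext e
    simp only [mem_filter, mem_sdiff, mem_union, not_or]
    constructor
    · rintro ⟨heM, h⟩; exact ⟨heM, by have := (kvec_trip_eq_zero_iff hOM κ heM).1 h; tauto⟩
    · rintro ⟨heM, h⟩; exact ⟨heM, (kvec_trip_eq_zero_iff hOM κ heM).2 (by tauto)⟩
  rw [hset]

omit [Fintype V] in
/-- **Dictionary**: a signed sum over the states of `M` at the diagonal base `(O,O,O)` is the pattern-weighted sum over all triples inside `D`. [this work] -/
theorem sum_Asg_eq_sum_triples (hO : O ⊆ D) (hM : M ⊆ D) (hOM : Disjoint O M) (φ : (Fin 3 → Finset (Sym2 V)) → ℝ) :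
    ∑ κ ∈ Asg M, sgn M κ * φ (trip O O O κ) = ∑ x ∈ triples D, pwt O M (kvec x) * φ x := by
  -- restrict the right-hand side to the fitting triples
  rw [← sum_filter_add_sum_filter_not (triples D) (fun x => patt O M (kvec x))]
  have hz : ∑ x ∈ (triples D).filter (fun x => ¬ patt O M (kvec x)), pwt O M (kvec x) * φ x = 0 :=
    sum_eq_zero fun x hx => by rw [pwt, if_neg (mem_filter.1 hx).2, zero_mul]
  rw [hz, add_zero]
  -- bijection `κ ↦ trip O O O κ`
  refine sum_nbij' (fun κ => trip O O O κ) (fun x => (x 0 \ O, x 1 \ O, x 2 \ O)) ?_ ?_ ?_ ?_ ?_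
  · intro κ hκ
    obtain ⟨h1, h2, h3, -, -, -⟩ := mem_Asg.1 hκ
    refine mem_filter.2 ⟨mem_triples.2 fun i => ?_, patt_trip hOM hκ⟩
    fin_cases i
    · exact (trip_diag κ).1 ▸ union_subset hO (h1.trans hM)
    · exact (trip_diag κ).2.1 ▸ union_subset hO (h2.trans hM)
    · exact (trip_diag κ).2.2 ▸ union_subset hO (h3.trans hM)
  · intro x hx
    obtain ⟨hxD, hp⟩ := mem_filter.1 hx
    have hxD' := mem_triples.1 hxD
    -- membership facts from the pattern
    have key : ∀ e, (e ∈ x 0 ∨ e ∈ x 1 ∨ e ∈ x 2) → e ∉ O → e ∈ M ∧ ¬ (e ∈ x 0 ∧ e ∈ x 1) ∧ ¬ (e ∈ x 0 ∧ e ∈ x 2) ∧ ¬ (e ∈ x 1 ∧ e ∈ x 2) := by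
      intro e he heO
      obtain ⟨-, hM1, h0⟩ := hp e
      have heM : e ∈ M := by
        by_contra heM
        have h00 := h0 heO heM
        unfold kvec at h00
        rcases he with he | he | he <;> (simp only [he, if_true] at h00; split_ifs at h00 <;> omega)
      have hle := hM1 heM
      unfold kvec at hle
      refine ⟨heM, ?_, ?_, ?_⟩ <;> (rintro ⟨hh1, hh2⟩; simp only [hh1, hh2, if_true] at hle; split_ifs at hle <;> omega)
    refine mem_Asg.2 ⟨?_, ?_, ?_, ?_, ?_, ?_⟩
    · intro e he; obtain ⟨he0, heO⟩ := mem_sdiff.1 he; exact (key e (Or.inl he0) heO).1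
    · intro e he; obtain ⟨he0, heO⟩ := mem_sdiff.1 he; exact (key e (Or.inr (Or.inl he0)) heO).1
    · intro e he; obtain ⟨he0, heO⟩ := mem_sdiff.1 he; exact (key e (Or.inr (Or.inr he0)) heO).1
    · exact disjoint_left.2 fun e h1 h2 => (key e (Or.inl (mem_sdiff.1 h1).1) (mem_sdiff.1 h1).2).2.1 ⟨(mem_sdiff.1 h1).1, (mem_sdiff.1 h2).1⟩
    · exact disjoint_left.2 fun e h1 h2 => (key e (Or.inl (mem_sdiff.1 h1).1) (mem_sdiff.1 h1).2).2.2.1 ⟨(mem_sdiff.1 h1).1, (mem_sdiff.1 h2).1⟩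
    · exact disjoint_left.2 fun e h1 h2 => (key e (Or.inr (Or.inl (mem_sdiff.1 h1).1)) (mem_sdiff.1 h1).2).2.2.2 ⟨(mem_sdiff.1 h1).1, (mem_sdiff.1 h2).1⟩
  · intro κ hκ
    obtain ⟨h1, h2, h3, -, -, -⟩ := mem_Asg.1 hκ
    have d1 : Disjoint O κ.1 := hOM.mono_right h1
    have d2 : Disjoint O κ.2.1 := hOM.mono_right h2
    have d3 : Disjoint O κ.2.2 := hOM.mono_right h3
    simp only [(trip_diag κ).1, (trip_diag κ).2.1, (trip_diag κ).2.2, union_sdiff_left, sdiff_eq_self_of_disjoint d1.symm,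
      sdiff_eq_self_of_disjoint d2.symm, sdiff_eq_self_of_disjoint d3.symm]
  · intro x hx
    obtain ⟨-, hp⟩ := mem_filter.1 hx
    have hO3 : ∀ i, O ⊆ x i := by
      intro i e heO
      have := (hp e).1 heO
      unfold kvec at this
      by_contra hne
      fin_cases i <;> · simp only at hne; split_ifs at this <;> simp_all
    funext i
    fin_cases i
    · show trip O O O _ 0 = x 0
      rw [(trip_diag _).1]; exact union_sdiff_of_subset (hO3 0)
    · show trip O O O _ 1 = x 1
      rw [(trip_diag _).2.1]; exact union_sdiff_of_subset (hO3 1)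
    · show trip O O O _ 2 = x 2
      rw [(trip_diag _).2.2]; exact union_sdiff_of_subset (hO3 2)
  · intro κ hκ
    rw [pwt, if_pos (patt_trip hOM hκ), psgn_trip hOM κ]

end Dict

end ThreePointGamma

end Summit.CriticalPhenomena.PercolationContinuityZ3.Theorems

end
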